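import Literature.MathematicalPhysics.KineticTheory.HardSphereEulerSymmetricForm
import Literature.Analysis.PDE.TorusQuasilinearLocalExistence
import HarnessLib

/-!
# Local classical solutions of the hard-sphere Euler system: the discharge of
# `hsEuler_localExistence` (topic `MathematicalPhysics/KineticTheory`)

MathematicalPhysics/KineticTheory file (everything proved; no definitions, no named facts)
discharging the named fact `Literature.MathematicalPhysics.KineticTheory.hsEuler_localExistence`
(`HardSphereEulerLocalTheory`): for data with `ρ₀σ³ ≤ η₁` small, `ρ₀, θ₀ > 0`, smooth on `𝕋³`,
the compressible Euler system with the hard-sphere constitutive relation has a local-in-time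
classical solution. [cite: Dafermos2005, §5.1, Thm 5.1.1]

The proof follows Dafermos, Thm 5.1.1 / Majda, Thm 2.1 (Picard iteration on the linearised
symmetric hyperbolic system, energy estimates of high order, contraction in `L²`, limit): the
hard-sphere Euler system in the variables `(ρ, v, θ)` is a quasilinear symmetric hyperbolic
system `A⁰(V)∂ₜV + Σₖ Aₖ(V)∂ₖV = 0` with DIAGONAL positive definite `A⁰` on the state domain
`{ρ > 0, θ > 0, ρσ³ < η_c}` (`HardSphereEulerSymmetricForm`), so the general local existence
theorem in matrix form `Literature.Analysis.PDE.symmHyperbolicLocalExistence_of_diagonal`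
(`TorusQuasilinearLocalExistence`, built on `TorusQuasilinearScheme`/`Limit`, the linear theory
`TorusLinearSymmetricHyperbolic*`, the a-priori estimates `TorusQuasilinearAPriori` and the
Moser calculus `TorusMoserCommutator`) applies; the reduction of the Euler system to this form
and back is `hsEuler_localExistence_of_symmHyperbolicLocalExistence`, whose proof is repeated
here with the diagonal variant of its hypothesis.

## Mathlib / tree search

Tree: `hsEuler_localExistence_of_symmHyperbolicLocalExistence`, `hsSymA0_eq_diagonal`,
`contDiffOn_hsSymA0_hsSymA`, `posDef_hsSymA0`, `isSymm_hsSymA`, `exists_packing_threshold`,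
`IsHardSphereEulerSolution.of_symmVector` (`HardSphereEulerSymmetricForm`,
`HardSphereEulerLocalTheoryProofs`); `symmHyperbolicLocalExistence_of_diagonal`.

## References

* C. M. Dafermos, *Hyperbolic Conservation Laws in Continuum Physics*, 2nd ed., Grundlehren
  325, Springer 2005, §5.1, Thm 5.1.1, pp. 122–125. [`Dafermos2005`]
* A. Majda, *Compressible Fluid Flow and Systems of Conservation Laws in Several Space
  Variables*, Springer 1984, Ch. 2 §2.1, Thm 2.1. [`Majda1984`]
* T. Kato, Arch. Rational Mech. Anal. 58 (1975) 181–205. [`Kato1975`]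
-/

noncomputable section

open Set Filter Topology
open scoped ContDiff

namespace Literature.MathematicalPhysics.KineticTheory

open Literature.Analysis.FunctionSpaces Literature.Analysis.FunctionSpaces.Torus
open Literature.Analysis.PDE

/-- The hard-sphere `A⁰` is diagonal (off-diagonal entries vanish). [folklore] -/
theorem hsSymA0_apply_ne (F : ℝ → ℝ) (σ : ℝ) (v : EuclideanSpace ℝ (Fin 5)) {i j : Fin 5}
    (hij : i ≠ j) : hsSymA0 F σ v i j = 0 := by
  rw [hsSymA0_eq_diagonal]
  exact Matrix.diagonal_apply_ne _ hij

/-- **Local classical solutions of the hard-sphere Euler system** (discharge of the named fact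
`hsEuler_localExistence`): Dafermos's Theorem 5.1.1 for the compressible Euler system with the
hard-sphere constitutive relation and smooth periodic data of small packing fraction.
[cite: Dafermos2005, §5.1, Thm 5.1.1] -/
theorem hsEuler_localExistence_holds : hsEuler_localExistence := by
  intro η₀ hη₀ F hFa hF
  obtain ⟨η_c, hc0, hcη₀, hc⟩ := exists_packing_threshold hη₀ hFa
  refine ⟨η_c / 2, by positivity, fun σ hσ ρ₀ θ₀ u₀ hρ₀ hθ₀ hu₀ hρ₀pos hθ₀pos hpack₀ => ?_⟩
  -- hypotheses of the matrix-form existence theorem on `𝒪 = {ρ > 0, θ > 0, ρσ³ < η_c}`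
  obtain ⟨hA0s, hAs⟩ := contDiffOn_hsSymA0_hsSymA (F := F) hFa hσ.le hcη₀.le (σ := σ)
  have hPD : ∀ v ∈ hsStateDomain σ η_c, (hsSymA0 F σ v).PosDef := by
    intro v hv
    have hvpack : v 0 * σ ^ 3 ∈ Ioo 0 η₀ := ⟨mul_pos hv.1 (pow_pos hσ 3), hv.2.2.trans hcη₀⟩
    have hge := deriv_hsPressure_density_ge hFa hF hc hv.2.1 hvpack hv.2.2.le
    rw [deriv_hsPressure_density_eq_hsDpDrho hFa hF _ hvpack] at hge
    have hθ := hv.2.1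
    exact posDef_hsSymA0 F σ hv.1 hv.2.1 (lt_of_lt_of_le (by linarith) hge)
  have hdiag : ∀ v ∈ hsStateDomain σ η_c, ∀ i j, i ≠ j → hsSymA0 F σ v i j = 0 :=
    fun v _ i j hij => hsSymA0_apply_ne F σ v hij
  have hSy : ∀ k, ∀ v ∈ hsStateDomain σ η_c, (hsSymA F σ k v).IsSymm := fun k v _ =>
    isSymm_hsSymA F σ k v
  -- the data
  have hV₀ : IsSmooth (hsStateVec ρ₀ u₀ θ₀) := isSmooth_hsStateVec hρ₀ hθ₀ hu₀
  have hK : ∃ K, IsCompact K ∧ K ⊆ hsStateDomain σ η_c ∧ ∀ x, hsStateVec ρ₀ u₀ θ₀ x ∈ K := by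
    refine ⟨range (hsStateVec ρ₀ u₀ θ₀), isCompact_range hV₀.continuous, ?_, fun x => ⟨x, rfl⟩⟩
    rintro _ ⟨x, rfl⟩
    refine ⟨?_, ?_, ?_⟩
    · simpa using hρ₀pos x
    · simpa using hθ₀pos x
    · have h := hpack₀ x
      simp only [hsStateVec_apply_zero]
      linarith
  obtain ⟨T, hT, V, hV, hV0, hVO, hEq⟩ := symmHyperbolicLocalExistence_of_diagonal 5
    (hsStateDomain σ η_c) (hsSymA0 F σ) (hsSymA F σ) (isOpen_hsStateDomain σ η_c) hA0s hAs hPD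
    hdiag hSy (hsStateVec ρ₀ u₀ θ₀) hV₀ hK
  refine ⟨T, hT, fun t x => V t x 0, fun t x => V t x 4, fun t x => hsVelPart (V t x),
    IsHardSphereEulerSolution.of_symmVector hFa hF hcη₀ hc hσ hV hVO hEq, ?_, ?_, ?_⟩
  · funext x
    simp [hV0]
  · funext x
    simp [hV0]
  · funext x
    simp [hV0]

end Literature.MathematicalPhysics.KineticTheory

end
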